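import Summits.AtomisticToContinuum.HydrodynamicLimit.Theorems.InformationPercolationEnginePercolationClosesChaosDockingOwners
import HarnessLib

/-!
# Revealed-defect facts for the forecast transfer S6 / stub S8 of the line `equilibrium-forecast-chain-rule`
(crux `InformationPercolationEngine.PercolationClosesChaos`, stmt-AtomisticToContinuum-15178)

Support file (`--supports stmt-AtomisticToContinuum-15178`) of the registered stubs `stub_revealedDefectStability :
RevealedDefectStability` (S8, worker W6 of lead c3: audit + minimal-input typing) and `stub_forecastTransfer` (its hypothesis
H4 `RevealedSandwich`, worker W3). Cheap deterministic facts about the two objects of `RevealedDefectStability`: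

* `unitDefect` (the collision-weighted mean cross-ratio defect of an owned unit): `unitDefect_nonneg` (any point),
  `unitDefect_le` / `abs_unitDefect_le` (`≤ 2 CΨ` on the good set of the flow, from `ownedCount_mul_unitDefect_le` of the
  docking's piece C and the junk `0⁻¹ = 0` of a unit owning no collision), `unitDefect_eq_zero_of_not_mem` (vanishes off the
  box of cells);
* `defectOsc Ψ b c σ N Φ k q z = sSup {|unitDefect z' − unitDefect z| : z' ∈ Φ.good, seqHistLE k q z' = seqHistLE k q z}` (the
  oscillation of the unit defect over the good part of the revealed-data atom of `z`): the image set is BOUNDED ABOVE by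
  `2 CΨ + |unitDefect z|` whatever `z` is (`bddAbove_defectOsc_image`) — so `Real.sSup` is never the junk value of an unbounded
  set — `defectOsc_nonneg`, `defectOsc_le` (`≤ 2 CΨ + |unitDefect z|`), `defectOsc_le_of_mem_good` (`≤ 4 CΨ`), the registered
  headline `abs_unitDefect_sub_le_defectOsc` (`|unitDefect z' − unitDefect z| ≤ defectOsc z` for `z' ∈ Φ.good` on the atom of
  `z`: `le_csSup`), its two-point form `abs_unitDefect_sub_le_two_mul_defectOsc` (the diameter of `unitDefect` over the good
  part of an atom is at most twice the oscillation at any of its points — the nesting step of H4), the comparison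
  `defectOsc_le_two_mul_defectOsc` between two good points of one atom, and `defectOsc_eq_zero_of_not_mem`.

Elementary (`Real.sSup` API: `le_csSup`, `Real.sSup_le`, `Real.sSup_nonneg`); no dynamics beyond pieces C/C1 of the docking.
-/

noncomputable section

open MeasureTheory Set Filter Topology
open scoped ENNReal BigOperators Classical
open Literature.Analysis.FluidPDE Literature.MathematicalPhysics.KineticTheory
open Literature.MathematicalPhysics.KineticTheory.VelocityBlindPlacement

namespace Summit.AtomisticToContinuum.HydrodynamicLimit.Theorems.EquilibriumForecastLine

/-! ## The unit defect is nonnegative and bounded -/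

section Unit

variable {σ : ℝ} {N : ℕ} (Φ : Flow σ N)

/-- `unitDefect Ψ ≥ 0` at every point (`ownedCount ≥ 0`, `collPair 1 ≥ 0`, a `tsum` of nonnegative terms). [folklore] -/
theorem unitDefect_nonneg {c : ℝ} (hc : 0 ≤ c) (hσ : 0 < σ) (Ψ : V3 × V3 × V3 → ℝ) (k : ℕ) (q : Cell) (z : Phase N) :
    0 ≤ unitDefect Ψ c σ N Φ k q z := by
  unfold unitDefect
  refine mul_nonneg (inv_nonneg.2 (ownedCount_nonneg hc hσ Φ k q z)) (tsum_nonneg fun q' => ?_)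
  have h1 := collPair_one_nonneg hc hσ Φ k q q z
  have h2 := collPair_one_nonneg hc hσ Φ k q q' z
  have h3 := collPair_one_nonneg hc hσ Φ k q' q z
  split_ifs <;> positivity

/-- **`unitDefect Ψ ≤ 2 CΨ` on the good set** for a continuous mark test bounded by `CΨ`: a unit owning no collision has
`unitDefect = 0⁻¹ · … = 0`; otherwise divide `ownedCount · unitDefect ≤ 2 CΨ · ownedCount` (`ownedCount_mul_unitDefect_le`)
by the positive owned count. [folklore] -/
theorem unitDefect_le {z : Phase N} (hz : z ∈ Φ.good) {Ψ : V3 × V3 × V3 → ℝ} (hΨc : Continuous Ψ) {CΨ : ℝ}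
    (hΨ : ∀ p, |Ψ p| ≤ CΨ) {c : ℝ} (hc : 0 < c) (hσ : 0 < σ) (k : ℕ) (q : Cell) :
    unitDefect Ψ c σ N Φ k q z ≤ 2 * CΨ := by
  have hCΨ : 0 ≤ CΨ := (abs_nonneg _).trans (hΨ 0)
  rcases (ownedCount_nonneg hc.le hσ Φ k q z).eq_or_lt with h0 | hpos
  · have huD : unitDefect Ψ c σ N Φ k q z = 0 := by
      unfold unitDefect
      rw [← h0, inv_zero, zero_mul]
    rw [huD]
    positivity
  · have h := ownedCount_mul_unitDefect_le Φ hz hΨc hΨ hc hσ k q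
    rw [mul_comm (2 * CΨ)] at h
    exact le_of_mul_le_mul_left h hpos

/-- `|unitDefect Ψ| ≤ 2 CΨ` on the good set. [folklore] -/
theorem abs_unitDefect_le {z : Phase N} (hz : z ∈ Φ.good) {Ψ : V3 × V3 × V3 → ℝ} (hΨc : Continuous Ψ) {CΨ : ℝ}
    (hΨ : ∀ p, |Ψ p| ≤ CΨ) {c : ℝ} (hc : 0 < c) (hσ : 0 < σ) (k : ℕ) (q : Cell) :
    |unitDefect Ψ c σ N Φ k q z| ≤ 2 * CΨ := by
  rw [abs_of_nonneg (unitDefect_nonneg Φ hc.le hσ Ψ k q z)]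
  exact unitDefect_le Φ hz hΨc hΨ hc hσ k q

/-- `unitDefect` vanishes off the box of cells (no owned collision there). [folklore] -/
theorem unitDefect_eq_zero_of_not_mem {c : ℝ} (h : 0 < c * meanFreePath σ N) (Ψ : V3 × V3 × V3 → ℝ) (k : ℕ)
    {q : Cell} (hq : q ∉ cellBox (c * meanFreePath σ N)) (z : Phase N) : unitDefect Ψ c σ N Φ k q z = 0 := by
  unfold unitDefect
  rw [ownedCount_eq_zero_of_not_mem h Φ k hq z, inv_zero, zero_mul]

end Unit

/-! ## The oscillation of the unit defect over a revealed atom -/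

section Osc

variable {σ : ℝ} {N : ℕ} (Φ : Flow σ N)

/-- **The image set behind `defectOsc` is bounded above** (by `2 CΨ + |unitDefect z|`, for ANY base point `z`): the points
`z'` of the set are good, so `|unitDefect z'| ≤ 2 CΨ`. Hence `Real.sSup` in `defectOsc` is a genuine supremum (or `sSup ∅ = 0`
when the good part of the atom is empty, which requires `z ∉ Φ.good`). [folklore] -/
theorem bddAbove_defectOsc_image {Ψ : V3 × V3 × V3 → ℝ} (hΨc : Continuous Ψ) {CΨ : ℝ} (hΨ : ∀ p, |Ψ p| ≤ CΨ) {c : ℝ}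
    (hc : 0 < c) (hσ : 0 < σ) (b : ℝ) (k : ℕ) (q : Cell) (z : Phase N) :
    BddAbove ((fun z' => |unitDefect Ψ c σ N Φ k q z' - unitDefect Ψ c σ N Φ k q z|) ''
      (Φ.good ∩ {z' | seqHistLE b c σ N Φ k q z' = seqHistLE b c σ N Φ k q z})) := by
  refine ⟨2 * CΨ + |unitDefect Ψ c σ N Φ k q z|, ?_⟩
  rintro _ ⟨z', ⟨hz', -⟩, rfl⟩
  calc |unitDefect Ψ c σ N Φ k q z' - unitDefect Ψ c σ N Φ k q z|
      ≤ |unitDefect Ψ c σ N Φ k q z'| + |unitDefect Ψ c σ N Φ k q z| := abs_sub _ _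
    _ ≤ 2 * CΨ + |unitDefect Ψ c σ N Φ k q z| := by
        gcongr
        exact abs_unitDefect_le Φ hz' hΨc hΨ hc hσ k q

/-- `defectOsc ≥ 0` (a supremum of absolute values; `Real.sSup_nonneg`). [folklore] -/
theorem defectOsc_nonneg (Ψ : V3 × V3 × V3 → ℝ) (b c : ℝ) (k : ℕ) (q : Cell) (z : Phase N) :
    0 ≤ defectOsc Ψ b c σ N Φ k q z := by
  unfold defectOsc
  refine Real.sSup_nonneg ?_
  rintro _ ⟨z', -, rfl⟩
  exact abs_nonneg _

/-- **Registered headline `abs_unitDefect_sub_le_defectOsc` (the fact H4 `RevealedSandwich` consumes): for a good point `z'` on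
the revealed-data atom of `z` (same `seqHistLE b c σ N Φ k q`), `|unitDefect z' − unitDefect z| ≤ defectOsc … z`** (`le_csSup`
with `bddAbove_defectOsc_image`; no assumption on the base point `z`). [folklore] -/
theorem abs_unitDefect_sub_le_defectOsc : ∀ {σ : ℝ} {N : ℕ} (Φ : Flow σ N) {Ψ : V3 × V3 × V3 → ℝ}, Continuous Ψ → ∀ {CΨ : ℝ}, (∀ p, |Ψ p| ≤ CΨ) → ∀ {c : ℝ}, 0 < c → 0 < σ → ∀ (b : ℝ) (k : ℕ) (q : Cell) {z z' : Phase N}, z' ∈ Φ.good → seqHistLE b c σ N Φ k q z' = seqHistLE b c σ N Φ k q z → |unitDefect Ψ c σ N Φ k q z' - unitDefect Ψ c σ N Φ k q z| ≤ defectOsc Ψ b c σ N Φ k q z := by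
  intro σ N Φ Ψ hΨc CΨ hΨ c hc hσ b k q z z' hz' hh
  unfold defectOsc
  exact le_csSup (bddAbove_defectOsc_image Φ hΨc hΨ hc hσ b k q z) ⟨z', ⟨hz', hh⟩, rfl⟩

/-- `defectOsc … z ≤ 2 CΨ + |unitDefect z|` for any base point. [folklore] -/
theorem defectOsc_le {Ψ : V3 × V3 × V3 → ℝ} (hΨc : Continuous Ψ) {CΨ : ℝ} (hΨ : ∀ p, |Ψ p| ≤ CΨ) {c : ℝ} (hc : 0 < c)
    (hσ : 0 < σ) (b : ℝ) (k : ℕ) (q : Cell) (z : Phase N) :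
    defectOsc Ψ b c σ N Φ k q z ≤ 2 * CΨ + |unitDefect Ψ c σ N Φ k q z| := by
  have hCΨ : 0 ≤ CΨ := (abs_nonneg _).trans (hΨ 0)
  obtain ⟨-, hB⟩ := (bddAbove_defectOsc_image Φ hΨc hΨ hc hσ b k q z)
  unfold defectOsc
  refine Real.sSup_le (fun x hx => ?_) (by positivity)
  obtain ⟨z', ⟨hz', -⟩, rfl⟩ := hx
  calc |unitDefect Ψ c σ N Φ k q z' - unitDefect Ψ c σ N Φ k q z|
      ≤ |unitDefect Ψ c σ N Φ k q z'| + |unitDefect Ψ c σ N Φ k q z| := abs_sub _ _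
    _ ≤ 2 * CΨ + |unitDefect Ψ c σ N Φ k q z| := by
        gcongr
        exact abs_unitDefect_le Φ hz' hΨc hΨ hc hσ k q

/-- On the good set `defectOsc ≤ 4 CΨ`. [folklore] -/
theorem defectOsc_le_of_mem_good {z : Phase N} (hz : z ∈ Φ.good) {Ψ : V3 × V3 × V3 → ℝ} (hΨc : Continuous Ψ) {CΨ : ℝ}
    (hΨ : ∀ p, |Ψ p| ≤ CΨ) {c : ℝ} (hc : 0 < c) (hσ : 0 < σ) (b : ℝ) (k : ℕ) (q : Cell) :
    defectOsc Ψ b c σ N Φ k q z ≤ 4 * CΨ := by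
  have h1 := defectOsc_le Φ hΨc hΨ hc hσ b k q z
  have h2 := abs_unitDefect_le Φ hz hΨc hΨ hc hσ k q
  linarith

/-- **The diameter of `unitDefect` over the good part of an atom is at most twice the oscillation at any of its points**:
for `z', z''` good on the atom of `z`, `|unitDefect z' − unitDefect z''| ≤ 2 · defectOsc … z` (the nesting step of H4:
`unitDefect z' > η` and `unitDefect z'' ≤ η/2` on the atom of `z` force `defectOsc z ≥ η/4`). [folklore] -/
theorem abs_unitDefect_sub_le_two_mul_defectOsc {Ψ : V3 × V3 × V3 → ℝ} (hΨc : Continuous Ψ) {CΨ : ℝ}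
    (hΨ : ∀ p, |Ψ p| ≤ CΨ) {c : ℝ} (hc : 0 < c) (hσ : 0 < σ) (b : ℝ) (k : ℕ) (q : Cell) {z z' z'' : Phase N}
    (hz' : z' ∈ Φ.good) (hz'' : z'' ∈ Φ.good) (h' : seqHistLE b c σ N Φ k q z' = seqHistLE b c σ N Φ k q z)
    (h'' : seqHistLE b c σ N Φ k q z'' = seqHistLE b c σ N Φ k q z) :
    |unitDefect Ψ c σ N Φ k q z' - unitDefect Ψ c σ N Φ k q z''| ≤ 2 * defectOsc Ψ b c σ N Φ k q z := by
  have h1 := abs_unitDefect_sub_le_defectOsc Φ hΨc hΨ hc hσ b k q hz' h'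
  have h2 := abs_unitDefect_sub_le_defectOsc Φ hΨc hΨ hc hσ b k q hz'' h''
  calc |unitDefect Ψ c σ N Φ k q z' - unitDefect Ψ c σ N Φ k q z''|
      = |(unitDefect Ψ c σ N Φ k q z' - unitDefect Ψ c σ N Φ k q z) -
          (unitDefect Ψ c σ N Φ k q z'' - unitDefect Ψ c σ N Φ k q z)| := by ring_nf
    _ ≤ |unitDefect Ψ c σ N Φ k q z' - unitDefect Ψ c σ N Φ k q z| +
          |unitDefect Ψ c σ N Φ k q z'' - unitDefect Ψ c σ N Φ k q z| := abs_sub _ _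
    _ ≤ 2 * defectOsc Ψ b c σ N Φ k q z := by linarith

/-- Two good points of one atom have comparable oscillations: `defectOsc z ≤ 2 · defectOsc z̃`. [folklore] -/
theorem defectOsc_le_two_mul_defectOsc {Ψ : V3 × V3 × V3 → ℝ} (hΨc : Continuous Ψ) {CΨ : ℝ} (hΨ : ∀ p, |Ψ p| ≤ CΨ)
    {c : ℝ} (hc : 0 < c) (hσ : 0 < σ) (b : ℝ) (k : ℕ) (q : Cell) {z w : Phase N} (hz : z ∈ Φ.good)
    (hzw : seqHistLE b c σ N Φ k q z = seqHistLE b c σ N Φ k q w) :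
    defectOsc Ψ b c σ N Φ k q z ≤ 2 * defectOsc Ψ b c σ N Φ k q w := by
  have h0 := defectOsc_nonneg Φ Ψ b c k q w
  unfold defectOsc
  refine Real.sSup_le (fun x hx => ?_) (by positivity)
  obtain ⟨z', ⟨hz', hh⟩, rfl⟩ := hx
  exact abs_unitDefect_sub_le_two_mul_defectOsc Φ hΨc hΨ hc hσ b k q hz' hz (hh.trans hzw) hzw

/-- Off the box of cells `defectOsc` vanishes (the unit defect is identically `0` there). [folklore] -/
theorem defectOsc_eq_zero_of_not_mem {c : ℝ} (h : 0 < c * meanFreePath σ N) (Ψ : V3 × V3 × V3 → ℝ) (b : ℝ) (k : ℕ)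
    {q : Cell} (hq : q ∉ cellBox (c * meanFreePath σ N)) (z : Phase N) : defectOsc Ψ b c σ N Φ k q z = 0 := by
  unfold defectOsc
  have himg : (fun z' => |unitDefect Ψ c σ N Φ k q z' - unitDefect Ψ c σ N Φ k q z|) ''
      (Φ.good ∩ {z' | seqHistLE b c σ N Φ k q z' = seqHistLE b c σ N Φ k q z}) ⊆ {0} := by
    rintro _ ⟨z', -, rfl⟩
    show |unitDefect Ψ c σ N Φ k q z' - unitDefect Ψ c σ N Φ k q z| ∈ ({0} : Set ℝ)
    rw [unitDefect_eq_zero_of_not_mem Φ h Ψ k hq z', unitDefect_eq_zero_of_not_mem Φ h Ψ k hq z, sub_zero, abs_zero]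
    exact Set.mem_singleton 0
  rcases Set.subset_singleton_iff_eq.1 himg with he | he
  · rw [he, Real.sSup_empty]
  · rw [he, csSup_singleton]

end Osc

end Summit.AtomisticToContinuum.HydrodynamicLimit.Theorems.EquilibriumForecastLine

end
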